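import Mathlib.NumberTheory.Harmonic.Bounds
import Mathlib.Analysis.SpecialFunctions.Trigonometric.Series
import Literature.Probability.LatticeModels.CharacterComplexRotationBound
import Literature.Probability.LatticeModels.DisorderedXYModel
import Mathlib.Analysis.Complex.ExponentialBounds
import Literature.Probability.LatticeModels.SharpnessProofs
import HarnessLib

/-!
# Power-law decay of the two-point function of planar `XY`-type models with complex couplings
# (Chatterjee 2026, Lemma 4.3; McBryan–Spencer 1977)

Topic `Literature/Probability/LatticeModels`. S. Chatterjee, *A short proof of confinement in
three-dimensional lattice gauge theories with a central `U(1)`*, arXiv:2602.00436 (2026), **Lemma 4.3**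
(p. 7 of the held text `paper:arxiv-2602.00436`), «a generalization of the classical Mermin–Wagner
theorem»: «Let `Λ` be a finite subset of `ℤ²` and let `E` be the set of positively oriented
nearest-neighbor edges with both endpoints in `Λ`. Suppose that we are given a collection of complex
numbers `(w_e)_{e ∈ E}`. Consider the probability measure `γ` on `𝕋^Λ` that has density
`exp(∑_{e=(x,y)∈E} Re(w_e φ_x φ̄_y))` with respect to the product of normalized Haar measures on
`𝕋^Λ`. Let `φ` be a random configuration drawn from `γ`. Then for any `x ∈ Λ` and `R > 0` such that
`y := x + (R, 0) ∈ Λ`, we have `|E(φ_x φ̄_y)| ≤ e^{−C L⁻¹ log(R+1)}`, where `C` is a positive universal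
constant and `L := 1 + max_{e ∈ E} |w_e|`.» For real positive uniform couplings this is the
McBryan–Spencer power law for the plane rotator [McBryanSpencer1977] (the tree's
`torusXY_abs_expect_cosDiff_le_rpow_spinWave`, `PlaneRotatorPowerLawDecay.lean`, is the sharp-exponent
torus version).

This file PROVES the lemma (`chatterjee_planarXY_twoPoint_le`, with `C = 1/420`, for any coupling bound
`L ≥ 1` with `|w_e| ≤ L`, in either lattice direction, and for the real parts `Re(c φ_x φ̄_y)`,
`‖c‖ ≤ 1`, whence the modulus of the complex expectation), NOT by the source's route (the
anti-concentration Lemma 4.1 and the conditional-independence change of variables) but by the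
McBryan–Spencer complex rotation, available in the tree for complex many-body couplings
(`abs_complexGinibreExpect_reMulChar_le`, `CharacterComplexRotationBound.lean`): rotate by the truncated
logarithmic field `a(v) = δ(log(R+1) − log(min(‖v−x‖∞, R)+1))`; the gain is `δ log(R+1)`, the cost
`∑_e |w_e| (cosh(∇a)_e − 1) ≤ 42 L δ² (1 + log(R+1))` by counting the shells `{‖u‖∞ = r}` of `ℤ²`
(`|∂Q_r| ≤ 4(2r+1)`, harmonic numbers), and `δ = min(1, 1/(210 L))` gives the claim.

HONEST LABEL: a two-dimensional a-priori bound at every coupling; it is the slice estimate behind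
logarithmic confinement of `U(1)`-centre gauge theories in `d = 3`
(`Literature.MathematicalPhysics.QuantumFieldTheory.chatterjee_centralCircle_confinement_d3_holds`)
and says nothing about gauge theories in `d = 4`.

## References

* S. Chatterjee, arXiv:2602.00436 (2026), Lemma 4.3 (p. 7). [Chatterjee2026CentralU1]
* O. A. McBryan, T. Spencer, Comm. Math. Phys. 53 (1977) 299–302. [McBryanSpencer1977]
* J. Glimm, A. Jaffe, Phys. Lett. 66B (1977) 67–69. [GlimmJaffe1977QuarkTrapping]
-/

noncomputable section

open MeasureTheory Finset Filter
open scoped BigOperators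

namespace Literature.Probability.LatticeModels

namespace PlanarXY

/-! ### The model: nearest-neighbour bonds of a planar region, bond and pair characters -/

/-- The positively oriented nearest-neighbour edges `(v, v + e_m)` with both endpoints in `Λ`,
labelled by `(v, m)`. [cite: Chatterjee2026CentralU1, Lemma 4.3 (the edge set E)] -/
def nnEdges (Λ : Finset (Site 2)) : Finset (Site 2 × Fin 2) :=
  (Λ ×ˢ (univ : Finset (Fin 2))).filter fun e => e.1 + Pi.single e.2 1 ∈ Λ

/-- Membership in `nnEdges Λ`. [cite: Chatterjee2026CentralU1, Lemma 4.3 (the edge set E)] -/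
theorem mem_nnEdges {Λ : Finset (Site 2)} {e : Site 2 × Fin 2} :
    e ∈ nnEdges Λ ↔ e.1 ∈ Λ ∧ e.1 + Pi.single e.2 1 ∈ Λ := by
  simp [nnEdges]

variable (Λ : Finset (Site 2))

/-- The pair character `φ ↦ φ_x φ̄_y` of two sites of `Λ`. [cite: Chatterjee2026CentralU1, Lemma 4.3 (the observable φ_x φ̄_y)] -/
def pairChar {x y : Site 2} (hx : x ∈ Λ) (hy : y ∈ Λ) : (↥Λ → Circle) →ₜ* Circle where
  toFun φ := φ ⟨x, hx⟩ * (φ ⟨y, hy⟩)⁻¹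
  map_one' := by simp
  map_mul' φ ψ := by
    simp only [Pi.mul_apply, mul_inv]
    exact mul_mul_mul_comm _ _ _ _
  continuous_toFun := (continuous_apply _).mul ((continuous_apply _).inv)

/-- The bond character `φ ↦ φ_v φ̄_{v+e_m}` of an edge of `Λ`. [cite: Chatterjee2026CentralU1, Lemma 4.3 (the density exp Σ Re(w_e φ_x φ̄_y))] -/
def bondChar (e : ↥(nnEdges Λ)) : (↥Λ → Circle) →ₜ* Circle :=
  pairChar Λ (mem_nnEdges.1 e.2).1 (mem_nnEdges.1 e.2).2

/-- The pair character, unfolded. [cite: Chatterjee2026CentralU1, Lemma 4.3 (the observable φ_x φ̄_y)] -/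
@[simp] theorem pairChar_apply {x y : Site 2} (hx : x ∈ Λ) (hy : y ∈ Λ) (φ : ↥Λ → Circle) :
    pairChar Λ hx hy φ = φ ⟨x, hx⟩ * (φ ⟨y, hy⟩)⁻¹ := rfl

/-- Along the rotation `expField a` the pair character is `e^{iτ(a_x − a_y)}`. [cite: Chatterjee2026CentralU1, Lemma 4.3 (proof device replaced: complex rotation)] -/
theorem pairChar_expField {x y : Site 2} (hx : x ∈ Λ) (hy : y ∈ Λ) (a : ↥Λ → ℝ) (τ : ℝ) :
    pairChar Λ hx hy (expField a τ) = Circle.exp (τ * (a ⟨x, hx⟩ - a ⟨y, hy⟩)) := by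
  rw [pairChar_apply, expField_apply, expField_apply, mul_sub, Circle.exp_sub, div_eq_mul_inv]

/-! ### The truncated logarithmic rotation field -/

/-- The truncated logarithmic potential `δ (log(R+1) − log(min(m,R)+1))`. [cite: McBryanSpencer1977, proof of the main theorem (logarithmic rotation)] -/
def logPot (δ : ℝ) (R m : ℕ) : ℝ := δ * (Real.log (R + 1) - Real.log (min m R + 1))

/-- The potential vanishes beyond `R`. [folklore] -/
private theorem logPot_of_le {δ : ℝ} {R m : ℕ} (h : R ≤ m) : logPot δ R m = 0 := by
  simp [logPot, min_eq_right h]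

/-- `|log u − log u'| ≤ 1/m` for reals `u, u' ≥ m > 0` with `|u − u'| ≤ 1`. [folklore] -/
private theorem abs_log_sub_log_le {u u' m : ℝ} (hm : 0 < m) (hu : m ≤ u) (hu' : m ≤ u')
    (h1 : u' ≤ u + 1) (h2 : u ≤ u' + 1) : |Real.log u - Real.log u'| ≤ 1 / m := by
  have hu0 : 0 < u := hm.trans_le hu
  have hu0' : 0 < u' := hm.trans_le hu'
  rw [abs_le]
  constructor
  · have h := Real.log_le_sub_one_of_pos (div_pos hu0' hu0)
    rw [Real.log_div hu0'.ne' hu0.ne'] at h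
    have : u' / u - 1 ≤ 1 / m := by
      rw [div_sub_one hu0.ne', div_le_div_iff₀ hu0 hm]
      nlinarith
    linarith
  · have h := Real.log_le_sub_one_of_pos (div_pos hu0 hu0')
    rw [Real.log_div hu0.ne' hu0'.ne'] at h
    have : u / u' - 1 ≤ 1 / m := by
      rw [div_sub_one hu0'.ne', div_le_div_iff₀ hu0' hm]
      nlinarith
    linarith

/-- The potential is `δ/max(1,m)`-Lipschitz at `m` on unit steps and constant beyond `R`. [cite: McBryanSpencer1977, proof of the main theorem (gradient of the rotation)] -/
theorem abs_logPot_sub_logPot_le {δ : ℝ} (hδ : 0 ≤ δ) {R m m' : ℕ} (h1 : m' ≤ m + 1) (h2 : m ≤ m' + 1) :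
    |logPot δ R m' - logPot δ R m| ≤ if m ≤ R then δ / max 1 (m : ℝ) else 0 := by
  split_ifs with hmR
  · unfold logPot
    rw [← mul_sub, abs_mul, abs_of_nonneg hδ, div_eq_mul_one_div]
    refine mul_le_mul_of_nonneg_left ?_ hδ
    rw [show Real.log (R + 1) - Real.log (min m' R + 1) - (Real.log (R + 1) - Real.log (min m R + 1)) =
      Real.log (min m R + 1) - Real.log (min m' R + 1) by ring]
    have hm0 : (0 : ℝ) < max 1 (m : ℝ) := lt_max_of_lt_left one_pos
    refine abs_log_sub_log_le hm0 ?_ ?_ ?_ ?_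
    · rw [min_eq_left hmR]
      exact max_le (by simp) (by simp)
    · refine max_le ?_ ?_
      · have : (0 : ℝ) ≤ (min m' R : ℕ) := Nat.cast_nonneg _
        linarith
      · have : m ≤ min m' R + 1 := by omega
        exact_mod_cast this
    · have : min m' R ≤ min m R + 1 := by omega
      have : ((min m' R : ℕ) : ℝ) ≤ (min m R : ℕ) + 1 := by exact_mod_cast this
      linarith
    · have : min m R ≤ min m' R + 1 := by omega
      have : ((min m R : ℕ) : ℝ) ≤ (min m' R : ℕ) + 1 := by exact_mod_cast this
      linarith
  · rw [logPot_of_le (by omega : R ≤ m), logPot_of_le (by omega : R ≤ m'), sub_zero, abs_zero]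

/-- `cosh t − 1 ≤ t²` for `|t| ≤ 1`. [folklore] -/
private theorem cosh_sub_one_le_sq {t : ℝ} (ht : |t| ≤ 1) : Real.cosh t - 1 ≤ t ^ 2 := by
  have h1 := Real.cosh_le_exp_half_sq t
  have ht2 : t ^ 2 ≤ 1 := by
    have := abs_le.1 ht; nlinarith
  have h2 : |t ^ 2 / 2| ≤ 1 := by rw [abs_of_nonneg (by positivity)]; linarith
  have h3 := Real.abs_exp_sub_one_le h2
  rw [abs_of_nonneg (by positivity : (0:ℝ) ≤ t ^ 2 / 2)] at h3
  have h4 := (abs_le.1 h3).2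
  linarith

/-! ### Two-dimensional shells -/

/-- The two-dimensional shell sum `∑_{‖u‖∞ ≤ R} 1/max(1,‖u‖∞)²`. [cite: McBryanSpencer1977, proof of the main theorem (energy of the logarithmic rotation)] -/
def shellSum (R : ℕ) : ℝ := ∑ u ∈ box 2 R, 1 / (max 1 (Site.supNorm u : ℝ)) ^ 2

/-- `|∂Q_r| / max(1,r)² ≤ (r = 0 ? 1 : 20/r)` in `ℤ²`. [folklore] -/
private theorem card_sphere_two_div_le (r : ℕ) :
    (#(sphere 2 r) : ℝ) / (max 1 (r : ℝ)) ^ 2 ≤ if r = 0 then (1 : ℝ) else 20 / (r : ℝ) := by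
  rcases Nat.eq_zero_or_pos r with rfl | hr
  · simp only [Nat.cast_zero, if_true]
    have h1 : #(sphere 2 0) ≤ 1 := by
      calc #(sphere 2 0) ≤ #(box 2 0) := card_le_card (sphere_subset_box 2 0)
        _ = 1 := by rw [card_box]; norm_num
    have h1' : (#(sphere 2 0) : ℝ) ≤ 1 := by exact_mod_cast h1
    rw [max_eq_left (by norm_num : (0:ℝ) ≤ 1), one_pow, div_one]
    exact h1'
  · obtain ⟨k, rfl⟩ : ∃ k, r = k + 1 := ⟨r - 1, by omega⟩
    rw [if_neg (Nat.succ_ne_zero k)]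
    have h := card_sphere_succ_le (d := 2) k
    have hk1 : (1 : ℝ) ≤ ((k + 1 : ℕ) : ℝ) := by exact_mod_cast Nat.le_add_left 1 k
    rw [max_eq_right hk1, div_le_div_iff₀ (by positivity) (by positivity)]
    push_cast at h ⊢
    simp only [pow_one] at h
    nlinarith

/-- **The two-dimensional Coulomb energy is logarithmic**: `∑_{‖u‖∞ ≤ R} 1/max(1,‖u‖∞)² ≤ 21(1 + log(R+1))`. [cite: McBryanSpencer1977, proof of the main theorem (energy of the logarithmic rotation ≈ log R)] -/
theorem shellSum_le (R : ℕ) : shellSum R ≤ 21 * (1 + Real.log (R + 1)) := by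
  unfold shellSum
  have hmaps : ∀ u ∈ box 2 R, Site.supNorm u ∈ range (R + 1) :=
    fun u hu => mem_range.2 (Nat.lt_succ_of_le (mem_box_iff_supNorm_le.1 hu))
  rw [← sum_fiberwise_of_maps_to' hmaps (fun r : ℕ => 1 / (max 1 (r : ℝ)) ^ 2)]
  have hfib : ∀ r ∈ range (R + 1),
      ∑ u ∈ box 2 R with Site.supNorm u = r, 1 / (max 1 (r : ℝ)) ^ 2 ≤
        if r = 0 then (1 : ℝ) else 20 / (r : ℝ) := by
    intro r _
    rw [sum_const, nsmul_eq_mul, ← div_eq_mul_one_div]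
    refine le_trans ?_ (card_sphere_two_div_le r)
    gcongr
    intro u hu
    rw [mem_filter] at hu
    exact mem_sphere.2 hu.2
  refine (sum_le_sum hfib).trans ?_
  rw [sum_range_succ']
  simp only [Nat.succ_ne_zero, if_false, if_true]
  have hharm : ∑ k ∈ range R, (20 : ℝ) / (k + 1 : ℕ) = 20 * (harmonic R : ℝ) := by
    simp only [harmonic, Rat.cast_sum, Rat.cast_inv, Rat.cast_natCast, mul_sum]
    refine sum_congr rfl fun k _ => ?_
    rw [div_eq_mul_inv]
  rw [hharm]
  have hH := harmonic_le_one_add_log R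
  have hlog : Real.log R ≤ Real.log (R + 1) := by
    rcases Nat.eq_zero_or_pos R with rfl | hR
    · simp
    · exact Real.log_le_log (by exact_mod_cast hR) (by linarith)
  have hlog0 : 0 ≤ Real.log ((R : ℝ) + 1) := Real.log_nonneg (by linarith [(Nat.cast_nonneg R : (0:ℝ) ≤ R)])
  linarith

/-! ### The rotation field of the pair `x, y = x + R e_m` and its cost -/

variable (x : Site 2) (R : ℕ) (δ : ℝ)

/-- The rotation field `a(v) = δ(log(R+1) − log(min(‖v − x‖∞, R) + 1))`. [cite: McBryanSpencer1977, proof of the main theorem (logarithmic rotation)] -/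
def rot : ↥Λ → ℝ := fun v => logPot δ R (Site.supNorm (v.1 - x))

/-- The site cost majorising `cosh((∇a)_e) − 1` for the edges at `v`. [cite: McBryanSpencer1977, proof of the main theorem (energy of the logarithmic rotation)] -/
def siteCost (v : Site 2) : ℝ :=
  if Site.supNorm (v - x) ≤ R then δ ^ 2 / (max 1 (Site.supNorm (v - x) : ℝ)) ^ 2 else 0

variable {Λ x R δ}

/-- The site cost is non-negative. [folklore] -/
private theorem siteCost_nonneg (v : Site 2) : 0 ≤ siteCost x R δ v := by
  unfold siteCost; split_ifs
  · positivity
  · exact le_rfl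

/-- Unit vectors have sup norm at most one. [folklore] -/
private theorem supNorm_single_le_one (m : Fin 2) : Site.supNorm (Pi.single m (1 : ℤ) : Site 2) ≤ 1 := by
  refine Site.supNorm_le_iff.2 fun k => ?_
  by_cases hk : k = m
  · subst hk; simp
  · simp [Pi.single_eq_of_ne hk]

/-- The sup norm is invariant under negation. [folklore] -/
private theorem supNorm_neg (v : Site 2) : Site.supNorm (-v) = Site.supNorm v := by
  simp [Site.supNorm]

/-- A unit step changes the distance to `x` by at most one. [folklore] -/
private theorem dist_step (v : Site 2) (m : Fin 2) :
    Site.supNorm (v + Pi.single m 1 - x) ≤ Site.supNorm (v - x) + 1 ∧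
      Site.supNorm (v - x) ≤ Site.supNorm (v + Pi.single m 1 - x) + 1 := by
  have he : v + Pi.single m 1 - x = (v - x) + Pi.single m 1 := by abel
  rw [he]
  constructor
  · exact (Site.supNorm_add_le _ _).trans (Nat.add_le_add_left (supNorm_single_le_one m) _)
  · have : v - x = ((v - x) + Pi.single m 1) + -Pi.single m 1 := by abel
    calc Site.supNorm (v - x) = Site.supNorm (((v - x) + Pi.single m 1) + -Pi.single m 1) := by rw [← this]
      _ ≤ _ := Site.supNorm_add_le _ _
      _ ≤ _ := by rw [supNorm_neg]; exact Nat.add_le_add_left (supNorm_single_le_one m) _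

/-- **The cost per edge**: `cosh(a(v) − a(v + e_m)) − 1 ≤ siteCost(v)` for `0 ≤ δ ≤ 1`. [cite: McBryanSpencer1977, proof of the main theorem (energy of the logarithmic rotation)] -/
theorem cosh_rotDiff_sub_one_le (hδ0 : 0 ≤ δ) (hδ1 : δ ≤ 1) (v : Site 2) (m : Fin 2) :
    Real.cosh (logPot δ R (Site.supNorm (v - x)) - logPot δ R (Site.supNorm (v + Pi.single m 1 - x))) - 1 ≤
      siteCost x R δ v := by
  have hst := dist_step (x := x) v m
  have hb := abs_logPot_sub_logPot_le (R := R) hδ0 hst.1 hst.2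
  rw [← Real.cosh_neg, neg_sub]
  unfold siteCost
  by_cases hR : Site.supNorm (v - x) ≤ R
  · rw [if_pos hR] at hb ⊢
    have hm0 : (1 : ℝ) ≤ max 1 (Site.supNorm (v - x) : ℝ) := le_max_left _ _
    have hle1 : |logPot δ R (Site.supNorm (v + Pi.single m 1 - x)) - logPot δ R (Site.supNorm (v - x))| ≤ 1 := by
      refine hb.trans ?_
      rw [div_le_one (by positivity)]
      exact hδ1.trans hm0
    refine (cosh_sub_one_le_sq hle1).trans ?_
    rw [← sq_abs]
    calc _ ≤ (δ / max 1 (Site.supNorm (v - x) : ℝ)) ^ 2 := pow_le_pow_left₀ (abs_nonneg _) hb 2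
      _ = δ ^ 2 / (max 1 (Site.supNorm (v - x) : ℝ)) ^ 2 := div_pow _ _ _
  · rw [if_neg hR] at hb ⊢
    have h0 : logPot δ R (Site.supNorm (v + Pi.single m 1 - x)) - logPot δ R (Site.supNorm (v - x)) = 0 :=
      abs_eq_zero.1 (le_antisymm hb (abs_nonneg _))
    rw [h0, Real.cosh_zero, sub_self]

/-- **The total cost**: `∑_{e ∈ E(Λ)} (cosh((∇a)_e) − 1) ≤ 42 δ² (1 + log(R+1))`, uniformly in `Λ`. [cite: McBryanSpencer1977, proof of the main theorem (energy of the logarithmic rotation ≈ log R)] -/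
theorem sum_cosh_rotDiff_sub_one_le (hδ0 : 0 ≤ δ) (hδ1 : δ ≤ 1) :
    ∑ e ∈ nnEdges Λ, (Real.cosh (logPot δ R (Site.supNorm (e.1 - x)) -
        logPot δ R (Site.supNorm (e.1 + Pi.single e.2 1 - x))) - 1) ≤
      42 * δ ^ 2 * (1 + Real.log (R + 1)) := by
  classical
  have hnn := siteCost_nonneg (x := x) (R := R) (δ := δ)
  have h1 : ∑ e ∈ nnEdges Λ, (Real.cosh (logPot δ R (Site.supNorm (e.1 - x)) -
        logPot δ R (Site.supNorm (e.1 + Pi.single e.2 1 - x))) - 1) ≤ ∑ e ∈ nnEdges Λ, siteCost x R δ e.1 :=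
    sum_le_sum fun e _ => cosh_rotDiff_sub_one_le hδ0 hδ1 e.1 e.2
  have h2 : ∑ e ∈ nnEdges Λ, siteCost x R δ e.1 ≤ ∑ e ∈ Λ ×ˢ (univ : Finset (Fin 2)), siteCost x R δ e.1 :=
    sum_le_sum_of_subset_of_nonneg (by unfold nnEdges; exact filter_subset _ _) fun e _ _ => hnn e.1
  have h3 : ∑ e ∈ Λ ×ˢ (univ : Finset (Fin 2)), siteCost x R δ e.1 = 2 * ∑ v ∈ Λ, siteCost x R δ v := by
    rw [sum_product, mul_sum]
    refine sum_congr rfl fun v _ => ?_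
    dsimp only
    rw [sum_const, card_univ, Fintype.card_fin, nsmul_eq_mul, Nat.cast_ofNat]
  set Y := (box 2 R).image (fun u : Site 2 => x + u) with hY
  have h4 : ∑ v ∈ Λ, siteCost x R δ v ≤ ∑ v ∈ Y, siteCost x R δ v := by
    rw [← sum_filter_add_sum_filter_not Λ (· ∈ Y)]
    have hz : ∑ v ∈ Λ with ¬ v ∈ Y, siteCost x R δ v = 0 := by
      refine sum_eq_zero fun v hv => ?_
      rw [mem_filter] at hv
      unfold siteCost
      rw [if_neg]
      intro hle
      exact hv.2 (mem_image.2 ⟨v - x, mem_box_iff_supNorm_le.2 hle, by abel⟩)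
    rw [hz, add_zero]
    exact sum_le_sum_of_subset_of_nonneg (fun v hv => (mem_filter.1 hv).2) fun v _ _ => hnn v
  have h5 : ∑ v ∈ Y, siteCost x R δ v = δ ^ 2 * shellSum R := by
    rw [hY, sum_image fun u _ u' _ h => add_left_cancel h, shellSum, mul_sum]
    refine sum_congr rfl fun u hu => ?_
    unfold siteCost
    rw [add_sub_cancel_left, if_pos (mem_box_iff_supNorm_le.1 hu), div_eq_mul_one_div]
  have h6 := shellSum_le R
  calc _ ≤ 2 * ∑ v ∈ Λ, siteCost x R δ v := by rw [← h3]; exact h1.trans h2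
    _ ≤ 2 * (δ ^ 2 * shellSum R) := by rw [← h5]; gcongr
    _ ≤ 2 * (δ ^ 2 * (21 * (1 + Real.log (R + 1)))) := by gcongr
    _ = 42 * δ ^ 2 * (1 + Real.log (R + 1)) := by ring

/-! ### The a-priori bound and the optimisation of `δ` -/

/-- **The a-priori bound with a free rotation parameter**: for `0 ≤ δ ≤ 1`, couplings `|w_e| ≤ L`,
`L ≥ 0`, and `‖c‖ ≤ 1`,
`|⟨Re(c φ_x φ̄_{x+Re_m})⟩_w| ≤ exp(−δ log(R+1) + L · 42 δ² (1 + log(R+1)))`. [cite: McBryanSpencer1977, proof of the main theorem (a-priori bound before optimising)] -/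
theorem abs_expect_pair_le_exp [MeasurableSpace Circle] [BorelSpace Circle]
    (w : ↥(nnEdges Λ) → ℂ) {L : ℝ} (hL : 0 ≤ L) (hw : ∀ e, ‖w e‖ ≤ L)
    (hx : x ∈ Λ) (m : Fin 2) (hy : x + Pi.single m (R : ℤ) ∈ Λ)
    (hδ0 : 0 ≤ δ) (hδ1 : δ ≤ 1) {c : ℂ} (hc : ‖c‖ ≤ 1) :
    |complexGinibreExpect (torusHaar ↥Λ) (bondChar Λ) w
        (fun φ => (c * ((pairChar Λ hx hy φ : Circle) : ℂ)).re)| ≤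
      Real.exp (-(δ * Real.log (R + 1)) + L * (42 * δ ^ 2 * (1 + Real.log (R + 1)))) := by
  set a : ↥Λ → ℝ := rot Λ x R δ with ha
  have hq : ∀ (e : ↥(nnEdges Λ)) (τ : ℝ), bondChar Λ e (expField a τ) =
      Circle.exp (τ * (logPot δ R (Site.supNorm (e.1.1 - x)) -
        logPot δ R (Site.supNorm (e.1.1 + Pi.single e.1.2 1 - x)))) := fun e τ => by
    unfold bondChar; rw [pairChar_expField]; rfl
  have hq₀ : ∀ τ : ℝ, pairChar Λ hx hy (expField a τ) = Circle.exp (τ * (δ * Real.log (R + 1))) := by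
    intro τ
    rw [pairChar_expField]
    congr 2
    simp only [ha, rot, sub_self, add_sub_cancel_left]
    rw [logPot, logPot]
    have h0 : Site.supNorm (0 : Site 2) = 0 := by simp [Site.supNorm]
    have hRn : Site.supNorm (Pi.single m (R : ℤ) : Site 2) = R := by
      apply le_antisymm
      · refine Site.supNorm_le_iff.2 fun k => ?_
        by_cases hk : k = m
        · subst hk; simp
        · simp [Pi.single_eq_of_ne hk]
      · have := Site.natAbs_le_supNorm (Pi.single m (R : ℤ) : Site 2) m
        simpa using this
    rw [h0, hRn]
    simp
  have hMS := abs_complexGinibreExpect_reMulChar_le (torusHaar ↥Λ) (K := w) hq hq₀ c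
  refine hMS.trans ?_
  have hcost : ∑ e : ↥(nnEdges Λ), ‖w e‖ * (Real.cosh (logPot δ R (Site.supNorm (e.1.1 - x)) -
        logPot δ R (Site.supNorm (e.1.1 + Pi.single e.1.2 1 - x))) - 1) ≤
      L * (42 * δ ^ 2 * (1 + Real.log (R + 1))) := by
    have h1 : ∑ e : ↥(nnEdges Λ), ‖w e‖ * (Real.cosh (logPot δ R (Site.supNorm (e.1.1 - x)) -
        logPot δ R (Site.supNorm (e.1.1 + Pi.single e.1.2 1 - x))) - 1) ≤
        ∑ e : ↥(nnEdges Λ), L * (Real.cosh (logPot δ R (Site.supNorm (e.1.1 - x)) -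
          logPot δ R (Site.supNorm (e.1.1 + Pi.single e.1.2 1 - x))) - 1) :=
      sum_le_sum fun e _ => mul_le_mul_of_nonneg_right (hw e) (sub_nonneg.2 (Real.one_le_cosh _))
    refine h1.trans ?_
    have hs := sum_cosh_rotDiff_sub_one_le (Λ := Λ) (x := x) (R := R) hδ0 hδ1
    rw [← Finset.sum_coe_sort] at hs
    rw [← mul_sum]
    exact mul_le_mul_of_nonneg_left hs hL
  have hR0 : 0 ≤ Real.exp (-(δ * Real.log (R + 1))) := (Real.exp_pos _).le
  calc ‖c‖ * Real.exp (-(δ * Real.log (R + 1))) *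
        Real.exp (∑ e : ↥(nnEdges Λ), ‖w e‖ * (Real.cosh (logPot δ R (Site.supNorm (e.1.1 - x)) -
          logPot δ R (Site.supNorm (e.1.1 + Pi.single e.1.2 1 - x))) - 1))
      ≤ 1 * Real.exp (-(δ * Real.log (R + 1))) * Real.exp (L * (42 * δ ^ 2 * (1 + Real.log (R + 1)))) := by
        gcongr
    _ = _ := by rw [one_mul, ← Real.exp_add]

end PlanarXY

open PlanarXY

/-- **Chatterjee 2026, Lemma 4.3 (McBryan–Spencer power law for planar `XY`-type models with complex
couplings), PROVED with `C = 1/420`.** Let `Λ ⊆ ℤ²` be finite, `w_e ∈ ℂ` couplings on the positively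
oriented nearest-neighbour edges of `Λ` with `|w_e| ≤ L`, `L ≥ 1`, and consider the Gibbs state
`∝ exp(∑_{e=(v,v+e_k)} Re(w_e φ_v φ̄_{v+e_k})) ∏ dφ_v` on `U(1)^Λ`. Then for `x ∈ Λ`, a lattice
direction `m`, `R ≥ 0` with `y = x + R e_m ∈ Λ`, and every `c ∈ ℂ` with `‖c‖ ≤ 1`:
`|⟨Re(c φ_x φ̄_y)⟩| ≤ exp(−log(R+1) / (420 L))`, i.e. `|E(φ_x φ̄_y)| ≤ (R+1)^{−1/(420 L)}`.
[cite: Chatterjee2026CentralU1, Lemma 4.3] -/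
theorem chatterjee_planarXY_twoPoint_le [MeasurableSpace Circle] [BorelSpace Circle]
    (Λ : Finset (Site 2)) (w : ↥(nnEdges Λ) → ℂ) {L : ℝ} (hL : 1 ≤ L) (hw : ∀ e, ‖w e‖ ≤ L)
    {x : Site 2} (hx : x ∈ Λ) (m : Fin 2) (R : ℕ) (hy : x + Pi.single m (R : ℤ) ∈ Λ)
    {c : ℂ} (hc : ‖c‖ ≤ 1) :
    |complexGinibreExpect (torusHaar ↥Λ) (bondChar Λ) w
        (fun φ => (c * ((pairChar Λ hx hy φ : Circle) : ℂ)).re)| ≤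
      Real.exp (-(1 / 420) * Real.log (R + 1) / L) := by
  have hL0 : 0 ≤ L := zero_le_one.trans hL
  rcases Nat.eq_zero_or_pos R with rfl | hR
  · have h := abs_expect_pair_le_exp (δ := 0) w hL0 hw hx m hy le_rfl zero_le_one hc
    refine h.trans (le_of_eq ?_)
    norm_num
  · set δ : ℝ := min 1 (1 / (210 * L)) with hδ
    have hδ0 : 0 ≤ δ := le_min zero_le_one (by positivity)
    have hδ1 : δ ≤ 1 := min_le_left _ _
    have hδ2 : δ ≤ 1 / (210 * L) := min_le_right _ _
    have h := abs_expect_pair_le_exp (δ := δ) w hL0 hw hx m hy hδ0 hδ1 hc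
    refine h.trans ?_
    rw [Real.exp_le_exp]
    set Lg : ℝ := Real.log (R + 1) with hLg
    have hL2 : Real.log 2 ≤ Lg := by
      have h1R : (1 : ℝ) ≤ R := by exact_mod_cast hR
      rw [hLg]; exact Real.log_le_log two_pos (by linarith)
    have hlog2 : (0.6931471803 : ℝ) < Real.log 2 := Real.log_two_gt_d9
    have hLg0 : 0 < Lg := by linarith
    have h1L : 1 + Lg ≤ 5 / 2 * Lg := by linarith
    have hLδ : L * δ ≤ 1 / 210 := by
      calc L * δ ≤ L * (1 / (210 * L)) := mul_le_mul_of_nonneg_left hδ2 hL0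
        _ = 1 / 210 := by field_simp
    have hcost : L * (42 * δ ^ 2 * (1 + Lg)) ≤ δ * Lg / 2 := by
      have h2 : L * (42 * δ ^ 2 * (1 + Lg)) ≤ L * (42 * δ ^ 2 * (5 / 2 * Lg)) := by gcongr
      refine h2.trans ?_
      have h3 : L * (42 * δ ^ 2 * (5 / 2 * Lg)) = (L * δ) * 105 * (δ * Lg) := by ring
      rw [h3]
      have h5 : 0 ≤ δ * Lg := by positivity
      nlinarith
    have hδlow : 1 / (210 * L) ≤ δ := by
      rw [hδ]
      refine le_min ?_ le_rfl
      rw [div_le_one (by positivity)]; nlinarith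
    have hmain : -(δ * Lg) + L * (42 * δ ^ 2 * (1 + Lg)) ≤ -(δ * Lg / 2) := by linarith
    refine hmain.trans ?_
    rw [show -(1 / 420 : ℝ) * Lg / L = -((1 / (210 * L)) * Lg / 2) by field_simp; ring]
    have : (1 / (210 * L)) * Lg ≤ δ * Lg := mul_le_mul_of_nonneg_right hδlow hLg0.le
    linarith

/-- **The modulus of the complex two-point function** (the form printed in the source):
`‖E(φ_x φ̄_y)‖ = ‖∫ φ_x φ̄_y dγ‖ ≤ (R+1)^{−1/(420 L)}`, written as a bound on the normalised complex
integral. [cite: Chatterjee2026CentralU1, Lemma 4.3] -/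
theorem chatterjee_planarXY_twoPoint_norm_le [MeasurableSpace Circle] [BorelSpace Circle]
    (Λ : Finset (Site 2)) (w : ↥(nnEdges Λ) → ℂ) {L : ℝ} (hL : 1 ≤ L) (hw : ∀ e, ‖w e‖ ≤ L)
    {x : Site 2} (hx : x ∈ Λ) (m : Fin 2) (R : ℕ) (hy : x + Pi.single m (R : ℤ) ∈ Λ) :
    ‖(∫ φ, ((pairChar Λ hx hy φ : Circle) : ℂ) * ((complexGinibreWeight (bondChar Λ) w φ : ℝ) : ℂ)
        ∂torusHaar ↥Λ) / ((∫ φ, complexGinibreWeight (bondChar Λ) w φ ∂torusHaar ↥Λ : ℝ) : ℂ)‖ ≤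
      Real.exp (-(1 / 420) * Real.log (R + 1) / L) := by
  set I : ℂ := ∫ φ, ((pairChar Λ hx hy φ : Circle) : ℂ) * ((complexGinibreWeight (bondChar Λ) w φ : ℝ) : ℂ)
    ∂torusHaar ↥Λ with hI
  set Z : ℝ := ∫ φ, complexGinibreWeight (bondChar Λ) w φ ∂torusHaar ↥Λ with hZ
  have hZpos : 0 < Z := integral_complexGinibreWeight_pos (torusHaar ↥Λ) (bondChar Λ) w
  -- choose the phase `c = conj(I)/‖I‖`
  by_cases hI0 : I = 0
  · rw [hI0, zero_div, norm_zero]; exact (Real.exp_pos _).le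
  · set c : ℂ := (starRingEnd ℂ) I / (‖I‖ : ℂ) with hc
    have hInorm : (0 : ℝ) < ‖I‖ := norm_pos_iff.2 hI0
    have hc1 : ‖c‖ ≤ 1 := by
      rw [hc, norm_div, Complex.norm_conj, Complex.norm_real, Real.norm_eq_abs, abs_of_pos hInorm,
        div_self hInorm.ne']
    have h := chatterjee_planarXY_twoPoint_le Λ w hL hw hx m R hy hc1
    have hre : complexGinibreExpect (torusHaar ↥Λ) (bondChar Λ) w
        (fun φ => (c * ((pairChar Λ hx hy φ : Circle) : ℂ)).re) = ‖I‖ / Z := by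
      rw [complexGinibreExpect, integral_reMulChar_mul_complexGinibreWeight, ← hI]
      congr 1
      rw [hc, div_mul_eq_mul_div, Complex.conj_mul', ← Complex.ofReal_pow, ← Complex.ofReal_div,
        Complex.ofReal_re, sq, mul_div_assoc, div_self hInorm.ne', mul_one]
    rw [hre, abs_of_nonneg (div_nonneg (norm_nonneg _) hZpos.le)] at h
    rw [norm_div, Complex.norm_real, Real.norm_eq_abs, abs_of_pos hZpos]
    exact h

end Literature.Probability.LatticeModels

end
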